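import Summits.QuantumFields.YangMills.Theorems.BalabanUVNodesN07Thm4RecordStructureA6
import Summits.QuantumFields.YangMills.Theorems.BalabanUVNodesN07NormalisationDbarFramesWide
import Literature.MathematicalPhysics.QuantumFieldTheory.Balaban1983to89.B15Claim189UnitTestAtRecord
import HarnessLib
/-!
# N07 [B11] (= [15] = [Balaban1985Variational]) Sect. F — **THE ONE CONDITIONAL PREMISE OF THE KNIT OF RECORD IN THE DOUBLE-BAR CURRENCY**: `HThm4RecDbar` = n07-w3 g8's
# `HThm4Rec` («[6] Theorem 4 ∕ Proposition 6 with [15] (152)–(153) and ū = 1 FOR THE RECORD STRUCTURE», Prop.-6 form) with the normalisation conjunct read at MODULE 91″'s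
# `NrmDbarWideOfRecord` ([3] (87)∕(92)∕(97): the accumulated symmetric double-bar frames, normalised on the cells of the WINDOW family `D̃ = □̃ ⊓ Ω(s)` — cure (α⁗-W) of ⚑ LOCATED-OUT-END-FRAME) instead of 60′'s `NrmOfRecordWide`; its COLLAR-UNIFORM premise of record `HThm4RecDbarUniform` (cure of
# ⚑ LOCATED-COLLAR-THRESHOLD); the door S1ᶜ to HS3NORM-67c at `Nrm := NrmDbarWideOfRecord`; the A6 certificate — cure (α‴) of ⚑ LOCATED-CPRIME-CURRENCY, plan g91 RULING A3⁗

Cell `pub-ymgap`, seat `pub-ymgap-dag-n07-e` g27 (typed) ∕ g28 (filed) (FAN-OUT §N07 row s3; LANE OWNER of the K0 road), MODULE 88″ = `HThm4Rec` + 84 + door + A6 at `NrmDbarWideOfRecord` in ONE file (INTENT-88″, cell bus; supersedes the held sym-currency draft 88).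
`--kind definition --supports stmt-QuantumFields-20541 --as helper` (K0⁷); count-neutral.  TWO `def`s (displayed premises, NEVER asserted) + bookkeeping theorems; nothing landed is
edited: n07-w3 g8's `…N07Thm4RecordStructure` (`HThm4Rec`, `HThm4RecEx`, `hS3NORM67c_of_hThm4Rec`) and `…A6` stay as the radial resting state, superseded BY NAME; their texts are
re-used here byte for byte except for the normalisation letter (`NrmOfRecordWide ↦ NrmDbarWideOfRecord`) and the binding of the collar (∃ρ₀ ↦ ∀ρ₀ with `ρmin ∣ ρ₀`).
[15] = [Balaban1985Variational]; [6] = [Balaban1985RegularSpaces]; [3] = [Balaban1985Averaging]; [I] = [Balaban1987RG1].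

WHY.  (1) ⚑ LOCATED-CPRIME-CURRENCY (desk memo; RULING A3⁗): the normalisation text of record is now `NrmDbarWideOfRecord` (S3's gauge read in the accumulated symmetric double-bar frames of [3] (97), print's (87)∕(92);
INHABITED by MODULE 92c's certificate `NrmDbarWideOfRecord.exists_of_reads`), so that the double-bar averages of the Landau copy ARE the plain averages of the representative (MODULE 91″
★★★`NrmDbarWideOfRecord.dbar_eq_iter_rep`) and linearise to the FLAT tube the chart reads (UST `norm_mlog_dbarIterU_sub_smul_bondAvgIter_le_of_reads`); the named premise and its door move
by that letter only.  (2) ⚑ LOCATED-COLLAR-THRESHOLD (desk memo; ref-G READ-496 REFEREE NOTE): the head's budget row needs the collar `ρ` above a threshold depending on [6] Prop. 6's constant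
`B₁`; the premise of record must therefore bind the collar UNIFORMLY («there exist B₁, c₁» over the whole big-block class, [6] Prop. 6 p. 99; print picks the collar AFTER `B₁`,
[15] (163) p. 304) — `HThm4RecDbarUniform := ∃ ρmin B₁ c₁, … ∀ ρ₀, ρmin ∣ ρ₀ → 1 ≤ ρ₀ → HThm4RecDbar … (ρ₀·L) (b9OfP …) (a0OfP …)` — and the monotonicity of the premise in its letters
lets the K0 assembler thread `κ := b9OfP·B₃` and shrink `a₀`.

WHAT IS DECLARED ∕ PROVED (sorry-free; axioms standard).
* §1 `HThm4RecDbar F N Mc ρ κ a₀ : Prop` — n07-w3's `HThm4Rec` text VERBATIM with `NrmOfRecordWide ↦ NrmDbarWideOfRecord`.  `hThm4RecDbar_mono` (monotone in `κ`, antitone in `a₀`).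
* §2 `HThm4RecDbarUniform F N Mc : Prop` — the collar-uniform premise of record; ★ `hThm4RecDbar_of_uniform_at` (the head's shape at every admissible collar: `κ := b9OfP·B₃`, `a₀′ ≤ a0OfP∕B₃`).
* §3 ★★★ `hS3NORM67c_of_hThm4RecDbar` — THE DOOR: HS3NORM-67c's clause (MODULE 67c ∕ 77c, `Nrm`-abstract) at `Nrm := NrmDbarWideOfRecord F N Mc ρ`, byte for byte n07-w3's proof.
* §4 A6: ★ `nrmDbarWideOfRecord_one` (UST `dbarIterU_one`∕`vframeU_one`: the accumulated frames of `(1^1)♮` are `≡ 1`), ★★ `hThm4RecDbar_conclusion_at_one` (the premise's ∃-conclusion inhabited at `U := 1`, `u := 1`, `A := 0`).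
HONEST LABEL (binding).  `HThm4RecDbar` ∕ `HThm4RecDbarUniform` are CONDITIONAL premises (print-licensed [I] pp. 253–254 — for the (0.4)∕(0.11) structure print itself says «valid
universally … proofs in most cases unchanged» — NOT print-proved for it; N05-REC's road, L++); this file DISCHARGES NOTHING of them; with them the knit of record is CONDITIONAL; N07 is NOT
claimable on road (β) while they are undischarged; K0⁷ ∕ K1⁹ NOT closed; N07 ∕ N05 NOT discharged; counts unmoved (typed 28∕28 · discharged 8∕27); one finite 𝕋⁴ programme at fixed ε —
the route closes the conditional finite-𝕋⁴ rung `BalabanLadder.UV` ONLY; the YM mass gap (Clay) is NOT proved by any of this; nothing continuum ∕ ℝ⁴ ∕ OS.  TWO `def`s, no `instance`,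
no `notation`, no `sorry`.

References: [6] Thm. 4 p. 88, Prop. 6 (1.130)–(1.138) p. 99, (1.29) p. 81, (1.38) p. 82; [15] (144) p. 300, (147)–(153) p. 301, (162)–(166) pp. 303–304; [3] (78)–(81) p. 30;
[I] (0.4)–(0.11) pp. 253–254.
-/

set_option autoImplicit false

noncomputable section

open scoped BigOperators Matrix.Norms.L2Operator

namespace Summit.QuantumFields.YangMills.BalabanUVNodes.N07Thm4RecordStructureDbar

open Literature.MathematicalPhysics.QuantumFieldTheory.Balaban1983to89
open Literature.MathematicalPhysics.QuantumFieldTheory.Balaban1983to89.Node00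
open Literature.MathematicalPhysics.QuantumFieldTheory.Balaban1983to89.B15DeterminingSets
open Literature.MathematicalPhysics.QuantumFieldTheory.Balaban1983to89.B12RegularSpaces111 (gaugeU expI grad)
open B15Eq112TorusCover (cover)
open B14DomainGeom (Pt Within)
open B8Eq131Cubes (sqLo sqHi box cube)
open B5Eq117TorusCarriers (Mk)
open B5Eq118OneStroke (iterBlockOf)
open B5Prop12FieldsLattice (distSite)
open B6SectADomainsV1 (Domains)
open B6SectAOperatorsV1 (BondIdx RE dsE QpE)
open Summit.QuantumFields.YangMills.Theorems.K0FlatCubeOpsTextP (flatH)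
open Summit.QuantumFields.YangMills.BalabanUVNodes.N07HalvingStepTopOfLocalLetters (Letters10On)
open Summit.QuantumFields.YangMills.BalabanUVNodes.N07LocalLettersCoreGuarded (DatumGaugeSplitTopStepCoreG)
open Summit.QuantumFields.YangMills.BalabanUVNodes.N07SplitClauseHeadKnitMeetNormalisedTower (datumGaugeSplitTopStepCoreG_of_normalisedGauge_of_chartMeetTower)
open Literature.MathematicalPhysics.QuantumFieldTheory.BalabanImbrieJaffe1984to88.BIJ85AxialPropagator411 (BondSpace)
open T4Continuum (T4Family)
open Summit.QuantumFields.YangMills.BalabanUVNodes.N07NormalisationDbarFramesWide (NrmDbarWideOfRecord)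
open Summit.QuantumFields.YangMills.BalabanUVNodes.N07NormalisationDbarFrames (toUT)
open Summit.QuantumFields.YangMills.BalabanUVNodes.N07DatumGauge152Guarded (two_mul_pow_le_sitesPerDir_of_levelGuard)

variable (F : T4Family) (N : ℕ) [NeZero N]

/-! ## §1  The named premise -/

/-- **`HThm4RecDbar` — [6] THEOREM 4 ∕ PROPOSITION 6 WITH [15] (152)–(153) AND «ū_j = 1 ON Λ′_j» FOR THE RECORD's AVERAGING STRUCTURE, PROPOSITION-6 FORM, AT EVERY MEETING DATUM OF A
SEPARATED RUN** (the ONE conditional premise of N07's knit of record, double-bar currency; plan g91 RULING A3⁗).  For the grid-cube size `Mc`, the collar `ρ`, the (152)-letter `κ` and the tolerance ceiling `a₀`: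
for every separated run with the collar floor and the no-wrap bound, every tolerance profile in range, every `SU(N)` field in the token's (1.7)∕(1.9) class on the record regions, every
level `1 ≤ j ≤ k` and every datum whose print box meets `Ω_j`, there are a torus gauge `u` and a potential `A` with HS3NORM-67c's nine rows at level `j` and `NrmDbarWideOfRecord … u A`
(MODULE 91″: S3's gauge read in the ACCUMULATED symmetric double-bar frames of [3] (97), print's (87)∕(92) — n07-w3's `HThm4Rec` text byte for byte with `NrmOfRecordWide ↦ NrmDbarWideOfRecord`).
Print-LICENSED by [I] p. 253–254 for the (0.4)∕(0.11) structure, NOT print-proved for it; NEVER asserted here. [cite: Balaban1985RegularSpaces, Thm. 4 p.88, Prop. 6 (1.130)–(1.138) p.99, (1.29) p.81, (1.38) p.82; Balaban1985Variational, (147)–(153) p.301; Balaban1985Averaging, (78)–(81) p.30; Balaban1987RG1, (0.4)–(0.9) pp.253–254] -/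
def HThm4RecDbar (Mc ρ : ℕ) (κ a₀ : ℝ) : Prop :=
  0 < κ → ∀ (ν : Stage7Numerics) (M : ℕ) (g : ℕ → ℝ) (K k : ℕ) (s : SeqOfRecord F ν M g K k), Sect2.SeqSeparated ν.M₁ s → 0 < ν.M₁ →
    (11 * 4 + 4 * ρ + Mc + 3) * F.L ≤ ν.M₁ → Mc + 11 * 4 + 6 * ρ ≤ (F.P K).sitesPerDir k → 1 ≤ k →
    ∀ (ε : ℕ → ℝ), (∀ n, n ≤ k → 0 < ε n ∧ ε n ≤ a₀) → (∀ n, n < k → ε n ≤ 2 * ε (n + 1)) →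
    ∀ U : GaugeField (F.P K) 0 (SU N),
    (∀ n, n ≤ k → PlaqSmallOn (Sect2.omegaPlaqsTop s.Ω (suppDomOfRecord F ν K s.Ω) n) (ε n * (F.P K).eta n ^ 2) U) →
    (∀ n, n ≤ k → Sect2.CoDivSmallOn (Sect2.omegaBondsTop s.Ω (suppDomOfRecord F ν K s.Ω) n) (ε n * (F.P K).eta n ^ 3) U) →
    ∀ (j : ℕ) (hk : j ≤ (F.P K).m + (F.P K).K), 1 ≤ j → j ≤ k → ∀ (idx : Pt (F.P K).d),
    (∃ x ∈ box (F.P K).L (cornerP (F.P K) Mc ρ idx) (sideP (F.P K) Mc ρ) j, ∃ y : Pt (F.P K).d, cover (F.P K) y ∈ s.Ω j ∧ Within ((3 : ℕ) : ℤ) x y) →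
    ∃ (u : GaugeTransf (F.P K) 0 (SU N)) (A : PBond (F.P K) 0 → MatA N),
      (∀ b ∈ (Sect2.regionOfSet (F.P K) (cover (F.P K) '' box (F.P K).L (cornerP (F.P K) Mc ρ idx) (sideP (F.P K) Mc ρ) j)).bonds,
        gaugeU (fun x => ιSU N (u x)) (fun b' => ιSU N (U b')) b = expI ((F.P K).eta j) (A b)) ∧
      (∀ b ∈ (Sect2.regionOfSet (F.P K) (cover (F.P K) '' cube (F.P K).L (cornerP (F.P K) Mc ρ idx) (sideP (F.P K) Mc ρ) ρ j 0)).bonds,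
        gaugeU (fun x => ιSU N (u x)) (fun b' => ιSU N (U b')) b = expI ((F.P K).eta j) (A b)) ∧
      (∀ j', j' ≤ j →
        ∀ b ∈ (Sect2.regionOfSet (F.P K) (cover (F.P K) '' cube (F.P K).L (cornerP (F.P K) Mc ρ idx) (sideP (F.P K) Mc ρ) ρ j j')).bonds,
          ‖A b‖ < κ * ε j * ((F.P K).L : ℝ) ^ (j - j')) ∧
      (∀ b ∈ (Sect2.regionOfSet (F.P K) (cover (F.P K) '' box (F.P K).L (cornerP (F.P K) Mc ρ idx) (sideP (F.P K) Mc ρ) j)).bonds,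
        ‖A b‖ < κ * ε j) ∧
      (∀ q ∈ (Sect2.regionOfSet (F.P K) (cover (F.P K) '' box (F.P K).L (cornerP (F.P K) Mc ρ idx) (sideP (F.P K) Mc ρ) j)).dpairs,
        ‖grad ((F.P K).eta j) q.2.1 (fun y => A ⟨y, q.2.2⟩) q.1‖ < κ * ε j) ∧
      (∀ b ∈ Sect2.bondsDeep (cover (F.P K) '' box (F.P K).L (cornerP (F.P K) Mc ρ idx) (sideP (F.P K) Mc ρ) j),
        ‖Sect2.codiffCurlA ((F.P K).eta j) A b.src b.dir‖ < κ * ε j) ∧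
      (∀ b ∈ Sect2.bondsDeep (cover (F.P K) '' box (F.P K).L (cornerP (F.P K) Mc ρ idx) (sideP (F.P K) Mc ρ) j),
        ‖∑ ν' : Fin (F.P K).d, (((F.P K).eta j : ℝ) : ℂ)⁻¹ •
            (grad ((F.P K).eta j) ν' (fun y => A ⟨y, b.dir⟩) (b.src.unshift ν') - grad ((F.P K).eta j) ν' (fun y => A ⟨y, b.dir⟩) b.src)‖ < κ * ε j) ∧
      (∀ φ : MatA N →L[ℂ] ℂ,
        RE (domainsMeet (cubeDomains (F.P K) (cornerP (F.P K) Mc ρ idx) (sideP (F.P K) Mc ρ) ρ j hk) (domainsOfSeq s.Ω j hk)) ((F.P K).eta j)⁻¹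
            (dsE ((F.P K).eta j)⁻¹ (WithLp.toLp 2 fun b => (φ (A b)).re : BondSpace (F.P K))) = 0 ∧
        RE (domainsMeet (cubeDomains (F.P K) (cornerP (F.P K) Mc ρ idx) (sideP (F.P K) Mc ρ) ρ j hk) (domainsOfSeq s.Ω j hk)) ((F.P K).eta j)⁻¹
            (dsE ((F.P K).eta j)⁻¹ (WithLp.toLp 2 fun b => (φ (A b)).im : BondSpace (F.P K))) = 0) ∧
      NrmDbarWideOfRecord F N Mc ρ ν M g K k s U j idx u A

/-! ## §2  The door: HS3NORM-67c with `Nrm := NrmDbarWideOfRecord` from `HThm4RecDbar` -/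

/-- ★★★ **THE CONDITIONAL DOOR S1ᶜ IN THE DOUBLE-BAR CURRENCY** (plan g91 RULING A3⁗; n07-w3 g8's `hS3NORM67c_of_hThm4Rec` byte for byte at `NrmDbarWideOfRecord`): from the named premise `HThm4RecDbar F N Mc ρ κ a₀` — together with the knit's own guard implication `Adm … → c ≤ ν.M₁ ∧ k + c₀ ≤
F.m + K`, the side conditions `(11·4 + 4ρ + Mc + 3)·L ≤ c`, `Mc + 11·4 + 6ρ ≤ 2·L^{c₀}` of its two constants and `0 < B₃`, all displayed by MODULE 67c — the hypothesis HS3NORM-67c of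
`…N07SplitClauseHeadKnitMeetNormalisedTower.datumGaugeSplitTopStepCoreG_of_normalisedGauge_of_chartMeetTower` BYTE FOR BYTE at `Nrm := NrmDbarWideOfRecord F N Mc ρ` (the `Nrm` text of record,
MODULE 91″ at the window family; 67c's and 77c's HS3NORM-67c clauses are `Nrm`-ABSTRACT and identical).  Bookkeeping only: the collar floor and the no-wrap bound are read off the guard (n07-w3 g7 `…DatumGauge152Guarded.two_mul_pow_le_sitesPerDir_of_levelGuard`), the tolerances'
positivity off `0 < δ_n`, `B₃δ_n ≤ ε_n`; the data `W`, `AgreeOn`, `IsCritOnFibre` and the clean-datum disjunction are not read. [cite: Balaban1985Variational, (144) p.300, (147)–(153) p.301; Balaban1985RegularSpaces, Prop. 6 p.99, Thm. 4 p.88, (1.29) p.81; Balaban1987RG1, (0.1) p.251, (0.4) p.253] -/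
theorem hS3NORM67c_of_hThm4RecDbar {ρ Mc : ℕ} {c c₀ : ℕ} (hc : (11 * 4 + 4 * ρ + Mc + 3) * F.L ≤ c) (hc₀ : Mc + 11 * 4 + 6 * ρ ≤ 2 * F.L ^ c₀)
    (Adm : StepGuard F) (hAdm : ∀ (ν : Stage7Numerics) (M : ℕ) (g : ℕ → ℝ) (K k : ℕ) (s : SeqOfRecord F ν M g K k), Adm ν M g K k s → c ≤ ν.M₁ ∧ k + c₀ ≤ F.m + K)
    {B₃ κ a₀ a₁ : ℝ} (hB₃ : 0 < B₃) (hκ : 0 < κ) (hT : HThm4RecDbar F N Mc ρ κ a₀) :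
    ∀ (ν : Stage7Numerics) (M : ℕ) (g : ℕ → ℝ) (K k : ℕ) (s : SeqOfRecord F ν M g K k), Sect2.SeqSeparated ν.M₁ s → 0 < ν.M₁ →
      Adm ν M g K k s → 1 ≤ k →
      ∀ (ε δ : ℕ → ℝ),
      (∀ n, n ≤ k → 0 < δ n ∧ δ n ≤ a₁) → (∀ n, n < k → δ n ≤ 2 * δ (n + 1)) → (∀ n, n < k → δ (n + 1) ≤ 2 * δ n) →
      (∀ n, n ≤ k → B₃ * δ n ≤ ε n ∧ ε n ≤ a₀) → (∀ n, n < k → ε n ≤ 2 * ε (n + 1)) → (∀ n, n < k → ε (n + 1) ≤ 2 * ε n) →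
      ∀ W : MSField (F.P K) (SU N), Sect2.DataSmall7PTop (avOfRecord F N K) s.Ω (suppDomOfRecord F ν K s.Ω) k δ W →
      ∀ U : GaugeField (F.P K) 0 (SU N),
      (∀ n, n ≤ k → PlaqSmallOn (Sect2.omegaPlaqsTop s.Ω (suppDomOfRecord F ν K s.Ω) n) (ε n * (F.P K).eta n ^ 2) U) →
      (∀ n, n ≤ k → Sect2.CoDivSmallOn (Sect2.omegaBondsTop s.Ω (suppDomOfRecord F ν K s.Ω) n) (ε n * (F.P K).eta n ^ 3) U) →
      AgreeOn (genSet s.Ω k) (avgFamily (avOfRecord F N K) U) W → IsCritOnFibre F N K (genSet s.Ω k) W U →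
      ∀ (n : ℕ) (hk : K - n ≤ (F.P K).m + (F.P K).K), 1 ≤ K - n → K - n ≤ k → ∀ (idx : Pt (F.P K).d),
      (∃ x ∈ box (F.P K).L (cornerP (F.P K) Mc ρ idx) (sideP (F.P K) Mc ρ) (K - n), ∃ y : Pt (F.P K).d, cover (F.P K) y ∈ s.Ω (K - n) ∧ Within ((3 : ℕ) : ℤ) x y) →
      (K - n = k ∨ ∀ z ∈ box (F.P K).L (cornerP (F.P K) Mc ρ idx - ((2 * ρ : ℕ) : Pt (F.P K).d)) (sideP (F.P K) Mc ρ + 2 * (2 * ρ)) (K - n),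
        cover (F.P K) z ∉ s.Ω (K - n + 1)) →
      ∃ (u : GaugeTransf (F.P K) 0 (SU N)) (A : PBond (F.P K) 0 → MatA N),
      (∀ b ∈ (Sect2.regionOfSet (F.P K) (cover (F.P K) '' box (F.P K).L (cornerP (F.P K) Mc ρ idx) (sideP (F.P K) Mc ρ) (K - n))).bonds,
        gaugeU (fun x => ιSU N (u x)) (fun b' => ιSU N (U b')) b = expI ((F.P K).eta (K - n)) (A b)) ∧
      (∀ b ∈ (Sect2.regionOfSet (F.P K) (cover (F.P K) '' cube (F.P K).L (cornerP (F.P K) Mc ρ idx) (sideP (F.P K) Mc ρ) ρ (K - n) 0)).bonds,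
        gaugeU (fun x => ιSU N (u x)) (fun b' => ιSU N (U b')) b = expI ((F.P K).eta (K - n)) (A b)) ∧
      (∀ j', j' ≤ K - n →
        ∀ b ∈ (Sect2.regionOfSet (F.P K) (cover (F.P K) '' cube (F.P K).L (cornerP (F.P K) Mc ρ idx) (sideP (F.P K) Mc ρ) ρ (K - n) j')).bonds,
          ‖A b‖ < κ * ε (K - n) * ((F.P K).L : ℝ) ^ (K - n - j')) ∧
      (∀ b ∈ (Sect2.regionOfSet (F.P K) (cover (F.P K) '' box (F.P K).L (cornerP (F.P K) Mc ρ idx) (sideP (F.P K) Mc ρ) (K - n))).bonds,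
        ‖A b‖ < κ * ε (K - n)) ∧
      (∀ q ∈ (Sect2.regionOfSet (F.P K) (cover (F.P K) '' box (F.P K).L (cornerP (F.P K) Mc ρ idx) (sideP (F.P K) Mc ρ) (K - n))).dpairs,
        ‖grad ((F.P K).eta (K - n)) q.2.1 (fun y => A ⟨y, q.2.2⟩) q.1‖ < κ * ε (K - n)) ∧
      (∀ b ∈ Sect2.bondsDeep (cover (F.P K) '' box (F.P K).L (cornerP (F.P K) Mc ρ idx) (sideP (F.P K) Mc ρ) (K - n)),
        ‖Sect2.codiffCurlA ((F.P K).eta (K - n)) A b.src b.dir‖ < κ * ε (K - n)) ∧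
      (∀ b ∈ Sect2.bondsDeep (cover (F.P K) '' box (F.P K).L (cornerP (F.P K) Mc ρ idx) (sideP (F.P K) Mc ρ) (K - n)),
        ‖∑ ν' : Fin (F.P K).d, (((F.P K).eta (K - n) : ℝ) : ℂ)⁻¹ •
            (grad ((F.P K).eta (K - n)) ν' (fun y => A ⟨y, b.dir⟩) (b.src.unshift ν') - grad ((F.P K).eta (K - n)) ν' (fun y => A ⟨y, b.dir⟩) b.src)‖ <
          κ * ε (K - n)) ∧
      (∀ D' : Domains (F.P K), LinearMap.ker (QpE D') ≤
          LinearMap.ker (QpE (domainsMeet (cubeDomains (F.P K) (cornerP (F.P K) Mc ρ idx) (sideP (F.P K) Mc ρ) ρ (K - n) hk) (domainsOfSeq s.Ω (K - n) hk))) →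
        ∀ φ : MatA N →L[ℂ] ℂ,
        RE D' ((F.P K).eta (K - n))⁻¹ (dsE ((F.P K).eta (K - n))⁻¹ (WithLp.toLp 2 fun b => (φ (A b)).re : BondSpace (F.P K))) = 0 ∧
        RE D' ((F.P K).eta (K - n))⁻¹ (dsE ((F.P K).eta (K - n))⁻¹ (WithLp.toLp 2 fun b => (φ (A b)).im : BondSpace (F.P K))) = 0) ∧
      NrmDbarWideOfRecord F N Mc ρ ν M g K k s U (K - n) idx u A := by
  intro ν M g K k s hsep hM₁ hadm hk1 ε δ hδ _ _ hεr hcomp _ W _ U h17 h19 _ _ n hk hn1 hnk idx hdat _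
  obtain ⟨hcν, hlevF⟩ := hAdm ν M g K k s hadm
  -- the collar floor and the no-wrap bound, read off the guard
  have hfl : (11 * 4 + 4 * ρ + Mc + 3) * F.L ≤ ν.M₁ := hc.trans hcν
  have hlevP : k + c₀ ≤ (F.P K).m + (F.P K).K := by rw [T4Family.P_m, T4Family.P_K]; exact hlevF
  have hlev : Mc + 11 * 4 + 6 * ρ ≤ (F.P K).sitesPerDir k := by
    refine hc₀.trans ?_
    have := two_mul_pow_le_sitesPerDir_of_levelGuard (P := F.P K) le_rfl hlevP
    rwa [T4Family.P_L] at this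
  -- the tolerances' range
  have hε : ∀ m, m ≤ k → 0 < ε m ∧ ε m ≤ a₀ := fun m hm =>
    ⟨lt_of_lt_of_le (mul_pos hB₃ (hδ m hm).1) (hεr m hm).1, (hεr m hm).2⟩
  obtain ⟨u, A, h1, hT1, hT2, h2, h3, h4, h5, h6, hN⟩ := hT hκ ν M g K k s hsep hM₁ hfl hlev hk1 ε hε hcomp U h17 h19 (K - n) hk hn1 hnk idx hdat
  exact ⟨u, A, h1, hT1, hT2, h2, h3, h4, h5, fun D' hD' φ => ⟨RE_eq_zero_of_ker_le hD' (h6 φ).1, RE_eq_zero_of_ker_le hD' (h6 φ).2⟩, hN⟩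



/-! ## §1b  Monotonicity of the premise in its letters (MODULE 84's `hThm4Rec_mono` at the double-bar text) -/

/-- **MONOTONICITY OF THE NAMED PREMISE**: for `0 < κ ≤ κ′` and `a₀′ ≤ a₀`, `HThm4RecDbar F N Mc ρ κ a₀ → HThm4RecDbar F N Mc ρ κ′ a₀′` — `κ` occurs only in the strict (152)-rows
`‖…‖ < κ·ε_j·(…)` (with `0 < ε_j`), `a₀` only in the tolerance ceiling `ε_n ≤ a₀`. [cite: Balaban1985RegularSpaces, Prop. 6 p.99; Balaban1985Variational, (152) p.301] -/
theorem hThm4RecDbar_mono {Mc ρ : ℕ} {κ κ' a₀ a₀' : ℝ} (h0 : 0 < κ) (hκ : κ ≤ κ') (ha : a₀' ≤ a₀) (h : HThm4RecDbar F N Mc ρ κ a₀) :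
    HThm4RecDbar F N Mc ρ κ' a₀' := by
  intro _ ν M g K k s hsep hM₁ hfl hnw hk ε hε hcomp U h17 h19 j hk' hj1 hjk idx hmeet
  have hε' : ∀ n, n ≤ k → 0 < ε n ∧ ε n ≤ a₀ := fun n hn => ⟨(hε n hn).1, (hε n hn).2.trans ha⟩
  obtain ⟨u, A, h1, hT1, hT2, h2, h3, h4, h5, h6, hN⟩ :=
    h h0 ν M g K k s hsep hM₁ hfl hnw hk ε hε' hcomp U h17 h19 j hk' hj1 hjk idx hmeet
  have hεj : 0 ≤ ε j := (hε j hjk).1.le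
  have hκε : κ * ε j ≤ κ' * ε j := mul_le_mul_of_nonneg_right hκ hεj
  refine ⟨u, A, h1, hT1, ?_, ?_, ?_, ?_, ?_, h6, hN⟩
  · intro j' hj' b hb
    exact (hT2 j' hj' b hb).trans_le (mul_le_mul_of_nonneg_right hκε (pow_nonneg (Nat.cast_nonneg _) _))
  · intro b hb; exact (h2 b hb).trans_le hκε
  · intro q hq; exact (h3 q hq).trans_le hκε
  · intro b hb; exact (h4 b hb).trans_le hκε
  · intro b hb; exact (h5 b hb).trans_le hκε

/-! ## §2  The collar-uniform premise of record (cure of ⚑ LOCATED-COLLAR-THRESHOLD; MODULE 84's text at the double-bar premise) -/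

/-- **`HThm4RecDbarUniform` — THE PREMISE OF RECORD, COLLAR-UNIFORM**: there are a big-block threshold `ρmin ≥ 1` and constants `B₁ ≥ 0`, `c₁ > 0` such that for EVERY `ρ₀ ≥ 1` with
`ρmin ∣ ρ₀` the named premise holds at the collar `ρ₀·L` with the (152)-letter `b9OfP F Mc (ρ₀·L) B₁` and the ceiling `a0OfP F N Mc (ρ₀·L) B₁ c₁` ([6] Prop. 6 p. 99 «there exist
constants B₁, c₁», uniform over the big-block class — the K0 assembler picks the collar AFTER `B₁`, as print does at [15] (163) p. 304).  A displayed premise, NEVER asserted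
(print-licensed [I] pp. 253–254 for the (0.4)∕(0.11) structure, not print-proved for it). [cite: Balaban1985RegularSpaces, Thm. 4 p.88, Prop. 6 (1.130)–(1.138) p.99; Balaban1985Variational, (144) p.300, (163) p.304; Balaban1987RG1, (0.11) p.253] -/
def HThm4RecDbarUniform (Mc : ℕ) : Prop :=
  ∃ (ρmin : ℕ) (B₁ c₁ : ℝ), 1 ≤ ρmin ∧ 0 ≤ B₁ ∧ 0 < c₁ ∧
    ∀ ρ₀ : ℕ, ρmin ∣ ρ₀ → 1 ≤ ρ₀ → HThm4RecDbar F N Mc (ρ₀ * F.L) (b9OfP F Mc (ρ₀ * F.L) B₁) (a0OfP F N Mc (ρ₀ * F.L) B₁ c₁)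

/-- ★ **THE HEAD's SHAPE AT EVERY ADMISSIBLE COLLAR**: from a uniform witness `(ρmin, B₁, c₁)`, for every `ρ₀ ≥ 1` with `ρmin ∣ ρ₀`, every `B₃ ≥ 1` and every ceiling
`a₀′ ≤ a0OfP F N Mc (ρ₀·L) B₁ c₁ ∕ B₃`, the premise holds at `(ρ₀·L, b9OfP·B₃, a₀′)` — the K0 assembler picks `ρ₀` AFTER `B₁` and the head's `C_H, B_H, δ_H` (MODULE 85's threshold) and
shrinks `a₀′` under the chain's `(16Q + 1024κ²)·a₀ ≤ 1`, `32κ·a₀ ≤ 1`. [cite: Balaban1985RegularSpaces, Prop. 6 p.99; Balaban1985Variational, (144) p.300, (152) p.301, (162)–(166) pp.303–304] -/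
theorem hThm4RecDbar_of_uniform_at {Mc ρmin : ℕ} {B₁ c₁ : ℝ} (hB₁ : 0 ≤ B₁) (hc₁ : 0 < c₁)
    (hall : ∀ ρ₀ : ℕ, ρmin ∣ ρ₀ → 1 ≤ ρ₀ → HThm4RecDbar F N Mc (ρ₀ * F.L) (b9OfP F Mc (ρ₀ * F.L) B₁) (a0OfP F N Mc (ρ₀ * F.L) B₁ c₁))
    {ρ₀ : ℕ} (hdvd : ρmin ∣ ρ₀) (hρ₀ : 1 ≤ ρ₀) {B₃ a₀' : ℝ} (hB₃ : 1 ≤ B₃) (ha₀' : a₀' ≤ a0OfP F N Mc (ρ₀ * F.L) B₁ c₁ / B₃) :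
    HThm4RecDbar F N Mc (ρ₀ * F.L) (b9OfP F Mc (ρ₀ * F.L) B₁ * B₃) a₀' := by
  have hb := b9OfP_pos (F := F) Mc (ρ₀ * F.L) hB₁
  have ha := a0OfP_pos (F := F) (N := N) Mc (ρ₀ * F.L) hB₁ hc₁
  exact hThm4RecDbar_mono F N hb (le_mul_of_one_le_right hb.le hB₃) (ha₀'.trans (div_le_self ha.le hB₃)) (hall ρ₀ hdvd hρ₀)

/-! ## §4  A6 certificate: the premise's conclusion is inhabited at the trivial field (`U = 1`: `u = 1`, `A = 0`) -/

section Vacuity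

open T4AxialGaugeRooted (axialGaugeAt)
open B15Eq177GaugeInvariance (blockLift)
open B12GaugeOrbits021 (IsResidual)
open GaugeField (gaugeAct)
open ExpMeanLog (expMeanLogSU)
open B8Eq131Cubes (tLo tHi ctr)
open Summit.QuantumFields.YangMills.BalabanUVNodes.N07Thm4RecordStructure (axialGaugeAt_one gaugeAct_one_one)
open Summit.QuantumFields.YangMills.BalabanUVNodes.N07RadialAxialTower (radialTower_one)
open Summit.QuantumFields.YangMills.Theorems.Prop8ChartDoubleBar (dbarIterU_one vframeU_one)
open B10Eq27TorusAxialLog (unitsField toUField suIncl val_unitsField)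

variable {F N}

/-- ★ **A6 CERTIFICATE FOR `NrmDbarWideOfRecord` AT THE TRIVIAL FIELD**: `NrmDbarWideOfRecord F N Mc ρ ν M g K k s 1 j idx 1 A` holds (witness `w := 1`: residual, the unit tower radial-axial,
the Landau copy `(1^1)♮ = 1` has trivial double-bar frames (UST `dbarIterU_one`, `vframeU_one`) so every accumulated-frame family is `≡ 1`, and the top axial gauge of `M^j(1) = 1` is `1`).
[cite: Balaban1985Variational, (152) p.301; Balaban1985Averaging, (79)–(81) p.30, (97) p.32 (bookkeeping)] -/
theorem nrmDbarWideOfRecord_one (Mc ρ : ℕ) (ν : Stage7Numerics) (M : ℕ) (g : ℕ → ℝ) (K k : ℕ) (s : SeqOfRecord F ν M g K k) (j : ℕ) (idx : Pt (F.P K).d)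
    (A : PBond (F.P K) 0 → MatA N) :
    NrmDbarWideOfRecord F N Mc ρ ν M g K k s (1 : GaugeField (F.P K) 0 (SU N)) j idx (fun _ => 1 : GaugeTransf (F.P K) 0 (SU N)) A := by
  refine ⟨fun _ => 1, fun _ => rfl, fun i _ => ?_, fun hk V hV0 hVs j' _ y _ => ?_⟩
  · rw [gaugeAct_one_one]
    exact radialTower_one F N K i
  · -- the Landau copy of the trivial field is trivial, and so are its double-bar frames: `V ≡ 1`
    have hX : unitsField (toUField (gaugeAct (fun _ => 1 : GaugeTransf (F.P K) 0 (SU N)) (1 : GaugeField (F.P K) 0 (SU N)))) =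
        fun _ : PBond (F.P K) 0 => (1 : (Matrix (Fin N) (Fin N) ℂ)ˣ) := by
      funext b
      apply Units.ext
      rw [val_unitsField, gaugeAct_one_one]
      show ((suIncl (1 : SU N) : Matrix.unitaryGroup (Fin N) ℂ) : Matrix (Fin N) (Fin N) ℂ) = ((1 : (Matrix (Fin N) (Fin N) ℂ)ˣ) : Matrix (Fin N) (Fin N) ℂ)
      rw [map_one]
      rfl
    have hV : ∀ (i : ℕ) (z : Site (F.P K) i), V i z = 1 := by
      intro i
      induction i with
      | zero => exact hV0
      | succ i ih => intro z; rw [hVs, hX, dbarIterU_one, vframeU_one, mul_one, ih]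
    have hfun : (fun x : Site (F.P K) 0 => blockLift j (axialGaugeAt (Averaging.iter (avOfRecord F N K) j
        (gaugeAct (fun _ => 1 : GaugeTransf (F.P K) 0 (SU N)) (1 : GaugeField (F.P K) 0 (SU N))))
          (tLo (cornerP (F.P K) Mc ρ idx) ρ) (tHi (cornerP (F.P K) Mc ρ idx) (sideP (F.P K) Mc ρ) ρ) (ctr (cornerP (F.P K) Mc ρ idx) (sideP (F.P K) Mc ρ))) x *
          (fun _ => 1 : GaugeTransf (F.P K) 0 (SU N)) x) = fun _ => 1 := by
      funext x
      rw [gaugeAct_one_one, B15Claim189UnitTestAtRecord.iter_avOfRecord_one, axialGaugeAt_one]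
      simp [blockLift]
    rw [hV, inv_one, one_mul, hfun]

/-- ★★ **A6 CERTIFICATE FOR `HThm4RecDbar`'s CONCLUSION AT THE TRIVIAL FIELD**: for `κ > 0`, `ε_j > 0`, every run and every datum, the ∃-clause of `HThm4RecDbar` at `U := 1` holds with `u := 1`,
`A := 0` — every gauge row reads `1 = e^{0}`, every letter row `‖0‖ < κ·ε_j·(…)`, every (153) row is a linear map at `0`, and `NrmDbarWideOfRecord … 1 j idx 1 0` by `nrmDbarWideOfRecord_one`.
(The premise itself is NOT proved by this; it shows its conclusion shape is consistent at the trivial point.) [cite: Balaban1985Variational, (152)–(153) p.301 (bookkeeping); Balaban1985RegularSpaces, (1.38) p.82] -/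
theorem hThm4RecDbar_conclusion_at_one (Mc ρ : ℕ) {κ : ℝ} (hκ : 0 < κ) (ν : Stage7Numerics) (M : ℕ) (g : ℕ → ℝ) (K k : ℕ) (s : SeqOfRecord F ν M g K k)
    {ε : ℕ → ℝ} (j : ℕ) (hk : j ≤ (F.P K).m + (F.P K).K) (idx : Pt (F.P K).d) (hε : 0 < ε j) :
    ∃ (u : GaugeTransf (F.P K) 0 (SU N)) (A : PBond (F.P K) 0 → MatA N),
      (∀ b ∈ (Sect2.regionOfSet (F.P K) (cover (F.P K) '' box (F.P K).L (cornerP (F.P K) Mc ρ idx) (sideP (F.P K) Mc ρ) j)).bonds,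
        gaugeU (fun x => ιSU N (u x)) (fun b' => ιSU N ((1 : GaugeField (F.P K) 0 (SU N)) b')) b = expI ((F.P K).eta j) (A b)) ∧
      (∀ b ∈ (Sect2.regionOfSet (F.P K) (cover (F.P K) '' cube (F.P K).L (cornerP (F.P K) Mc ρ idx) (sideP (F.P K) Mc ρ) ρ j 0)).bonds,
        gaugeU (fun x => ιSU N (u x)) (fun b' => ιSU N ((1 : GaugeField (F.P K) 0 (SU N)) b')) b = expI ((F.P K).eta j) (A b)) ∧
      (∀ j', j' ≤ j →
        ∀ b ∈ (Sect2.regionOfSet (F.P K) (cover (F.P K) '' cube (F.P K).L (cornerP (F.P K) Mc ρ idx) (sideP (F.P K) Mc ρ) ρ j j')).bonds,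
          ‖A b‖ < κ * ε j * ((F.P K).L : ℝ) ^ (j - j')) ∧
      (∀ b ∈ (Sect2.regionOfSet (F.P K) (cover (F.P K) '' box (F.P K).L (cornerP (F.P K) Mc ρ idx) (sideP (F.P K) Mc ρ) j)).bonds,
        ‖A b‖ < κ * ε j) ∧
      (∀ q ∈ (Sect2.regionOfSet (F.P K) (cover (F.P K) '' box (F.P K).L (cornerP (F.P K) Mc ρ idx) (sideP (F.P K) Mc ρ) j)).dpairs,
        ‖grad ((F.P K).eta j) q.2.1 (fun y => A ⟨y, q.2.2⟩) q.1‖ < κ * ε j) ∧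
      (∀ b ∈ Sect2.bondsDeep (cover (F.P K) '' box (F.P K).L (cornerP (F.P K) Mc ρ idx) (sideP (F.P K) Mc ρ) j),
        ‖Sect2.codiffCurlA ((F.P K).eta j) A b.src b.dir‖ < κ * ε j) ∧
      (∀ b ∈ Sect2.bondsDeep (cover (F.P K) '' box (F.P K).L (cornerP (F.P K) Mc ρ idx) (sideP (F.P K) Mc ρ) j),
        ‖∑ ν' : Fin (F.P K).d, (((F.P K).eta j : ℝ) : ℂ)⁻¹ •
            (grad ((F.P K).eta j) ν' (fun y => A ⟨y, b.dir⟩) (b.src.unshift ν') - grad ((F.P K).eta j) ν' (fun y => A ⟨y, b.dir⟩) b.src)‖ < κ * ε j) ∧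
      (∀ φ : MatA N →L[ℂ] ℂ,
        RE (domainsMeet (cubeDomains (F.P K) (cornerP (F.P K) Mc ρ idx) (sideP (F.P K) Mc ρ) ρ j hk) (domainsOfSeq s.Ω j hk)) ((F.P K).eta j)⁻¹
            (dsE ((F.P K).eta j)⁻¹ (WithLp.toLp 2 fun b => (φ (A b)).re : BondSpace (F.P K))) = 0 ∧
        RE (domainsMeet (cubeDomains (F.P K) (cornerP (F.P K) Mc ρ idx) (sideP (F.P K) Mc ρ) ρ j hk) (domainsOfSeq s.Ω j hk)) ((F.P K).eta j)⁻¹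
            (dsE ((F.P K).eta j)⁻¹ (WithLp.toLp 2 fun b => (φ (A b)).im : BondSpace (F.P K))) = 0) ∧
      NrmDbarWideOfRecord F N Mc ρ ν M g K k s (1 : GaugeField (F.P K) 0 (SU N)) j idx u A := by
  have hL : (1 : ℝ) ≤ (F.P K).L := by exact_mod_cast (F.P K).L_pos
  have hgauge : ∀ b : PBond (F.P K) 0, gaugeU (fun x => ιSU N ((fun _ => 1 : GaugeTransf (F.P K) 0 (SU N)) x)) (fun b' => ιSU N ((1 : GaugeField (F.P K) 0 (SU N)) b')) b =
      expI ((F.P K).eta j) ((0 : PBond (F.P K) 0 → MatA N) b) := by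
    intro b
    rw [Pi.zero_apply, B12RegularSpaces111Mono.expI_zero]
    show ιSU N 1 * ιSU N 1 * (ιSU N 1)⁻¹ = 1
    simp
  have hgrad : ∀ (ν' : Fin (F.P K).d) (x : Site (F.P K) 0), grad ((F.P K).eta j) ν' (fun _ : Site (F.P K) 0 => (0 : MatA N)) x = 0 := by
    intro ν' x; simp [grad]
  have hcurl : ∀ (x : Site (F.P K) 0) (ν' μ : Fin (F.P K).d), Sect2.curlA ((F.P K).eta j) (0 : PBond (F.P K) 0 → MatA N) x ν' μ = 0 := by
    intro x ν' μ; simp [Sect2.curlA, grad]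
  have hcodiff : ∀ (x : Site (F.P K) 0) (μ : Fin (F.P K).d), Sect2.codiffCurlA ((F.P K).eta j) (0 : PBond (F.P K) 0 → MatA N) x μ = 0 := by
    intro x μ; simp [Sect2.codiffCurlA, hcurl]
  have hpos : ∀ j' : ℕ, 0 < κ * ε j * ((F.P K).L : ℝ) ^ (j - j') := fun j' => by positivity
  have hκε : 0 < κ * ε j := mul_pos hκ hε
  refine ⟨fun _ => 1, 0, fun b _ => hgauge b, fun b _ => hgauge b, fun j' _ b _ => by simpa using hpos j', fun b _ => by simpa using hκε,
    fun q _ => ?_, fun b _ => ?_, fun b _ => ?_, fun φ => ?_, nrmDbarWideOfRecord_one Mc ρ ν M g K k s j idx 0⟩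
  · have : grad ((F.P K).eta j) q.2.1 (fun y => (0 : PBond (F.P K) 0 → MatA N) ⟨y, q.2.2⟩) q.1 = 0 := hgrad q.2.1 q.1
    rw [this, norm_zero]; exact hκε
  · rw [hcodiff, norm_zero]; exact hκε
  · have : ∀ ν' : Fin (F.P K).d, (((F.P K).eta j : ℝ) : ℂ)⁻¹ •
        (grad ((F.P K).eta j) ν' (fun y => (0 : PBond (F.P K) 0 → MatA N) ⟨y, b.dir⟩) (b.src.unshift ν') -
          grad ((F.P K).eta j) ν' (fun y => (0 : PBond (F.P K) 0 → MatA N) ⟨y, b.dir⟩) b.src) = 0 := by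
      intro ν'
      rw [show (fun y => (0 : PBond (F.P K) 0 → MatA N) ⟨y, b.dir⟩) = fun _ : Site (F.P K) 0 => (0 : MatA N) from rfl, hgrad, hgrad, sub_self, smul_zero]
    rw [Finset.sum_eq_zero fun ν' _ => this ν', norm_zero]; exact hκε
  · have hre : (WithLp.toLp 2 fun b => (φ ((0 : PBond (F.P K) 0 → MatA N) b)).re : BondSpace (F.P K)) = 0 := by
      ext b; simp
    have him : (WithLp.toLp 2 fun b => (φ ((0 : PBond (F.P K) 0 → MatA N) b)).im : BondSpace (F.P K)) = 0 := by
      ext b; simp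
    rw [hre, him, map_zero, map_zero]
    exact ⟨rfl, rfl⟩

end Vacuity

end Summit.QuantumFields.YangMills.BalabanUVNodes.N07Thm4RecordStructureDbar

end
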